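import Summits.QuantumFields.YangMills.Theorems.UnitScaleTiltHalvingP1FlatPillarPrime
import Summits.QuantumFields.YangMills.Theorems.UnitScaleTiltHalvingP1FlatPillarRows
import Summits.QuantumFields.YangMills.Theorems.UnitScaleTiltHalvingP1FlatCoreExtraction
import HarnessLib

/-!
# Route `UnitScaleTilt`, crux K1 child «MinimiserStabilityRegPr» (stmt-QuantumFields-19200), registered stub V2′ `stub_halvingStep` (v10 `BirthV10`) —
# **J5 EXTRACTION, PART 2: THE PRIMED PILLAR TEXT FROM ITS CORE** — `P1FlatPillarAt′` (✓`HalvingP1FlatPillarPrime`, (ii′) on the level-0 cube `□₀`) from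
# `core′` (its first five conjunct groups) at one site, and the outer knit — the ROOMED `P1FlatPillar′` text (room premise `2ρ + Nr ≤ L^{m+n}`, ★★OWNER RULING №27 ∕
# LEAD-H L-4) from a `core′` supplier at every site with room: the body of the door successor's `hP1room`

Cell `ym3-torus` (HUMAN RULING D-0037, YM ladder rung R3 — continuum SU(2) YM₃ on the three-torus is a RUNG, NOT the Clay problem), width seat `ym-ust-19936-w7`
gen 4, cross-item hand on line H (★★OWNER ym3-torus-plan g26 ACK 45 (a) «J5 EXTRACTION → ★w7-19936 g4: GO»; tag worded by the OWNER:
`--supports stmt-QuantumFields-19200 --as helper`).  Definition-free, 0 sorry, standard axioms.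

WHY.  ✓`HalvingP1FlatPillarRows.p1FlatPillarAt_of_core` ∕ `p1FlatPillar_of_core` (★w3-19200 g4) derive the two chart rows (vi) (160) and (vii) (155) of the UNPRIMED pillar
text from its core; LEAD RULING L-2 (1) moved the chart identity to (ii′) on the level-0 cube `□₀ = cubeSetM x (K−n) ρ S M 0` (✓p625022 `P1FlatPillarAt'`∕`P1FlatPillar'`),
and the door twin ✓`halvingStep_of_rows'` reads `hP1′ : … P1FlatPillar′ …`.  THIS FILE is the same knit for the primed text: the near row (vi) needs the chart on the
member's positive-level layers, which (ii′) on `□₀` supplies through ✓`HalvingP1FlatPillarPrime.sideTouches_subset_cube0` (separation `S ≥ 1`); the far row (vii) reads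
the sup sizes (iii) only (✓`far155_of_size152`).  With ✓`HalvingP1FlatCoreExtraction.core'_of_mlogChart` (part 1) the chain «J4 output ⟹ core′ ⟹ P1FlatPillarAt′ ⟹
P1FlatPillar′ ⟹ door» is by name.
* §1 ★ `p1FlatPillarAt'_of_core'` — `core′` at `D := cubeSeqMT3 …`, `Ω₀ := □₀` ⟹ `P1FlatPillarAt' … ε₀ ε₁ B₁ 6 (8L(B₁+1)) U`.
* §2 ★★ `p1FlatPillar'_room_of_core'` — a `core′` supplier at every member∕site WITH ROOM ⟹ the ROOMED primed pillar text (★★OWNER RULING №27 (1) ∕ LEAD-H RULING L-4: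
  the premise `2·ρ + Nr ≤ F.L ^ (F.m + n)` immediately after `hnK` inside `∀ F, F.L = L → ∀ n K hnK`; body = ✓`P1FlatPillar'` UNFOLDED, no new predicate), constants
  `C₁ = 6`, `C₂ = 8L(B₁+1)`, regimes `12(ρ+M)a ≤ Cr`, `60800·(5L)²·L·(B₁+1)·a ≤ 1`, cube data `R′M ≤ S`, `2L ≤ R′M + 1`, `1 ≤ S` — ✓`p1FlatPillar_of_core` :284 letter for
  letter with primes and the room premise threaded (the un-roomed `P1FlatPillar'` is uninhabitable at wrapping members, №27's flat abelian witness — not concluded here).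
* §3 ★★ `p1FlatPillar'_room_of_mlogChartData` — the same from J4's RAW per-site output at the members with room (an `SU(2)`-valued gauge with (o), the near-identity chart on
  the bonds of `□₀`, the chart-defined one-form, the (1.36)♭ sizes, the exact slice in `R ∘ ∂*` letters), through part 1's ✓`core'_of_mlogChart` — the ONE theorem the J4
  pair's rows feed; its conclusion is the body of the door successor's `hP1room` at fixed `(B₁, Nr, ρ, a, Cr)`.
HONEST SCOPE.  Knits over landed rows; the core′ itself (J1–J4: the flat one-contraction) is a HYPOTHESIS here.  NOT a claim about [Balaban1985RegularSpaces] Thm 2,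
the stub, the crux, the rung or the mass gap; no summit statement is proved by this seat.

References: T. Bałaban, CMP **99** (1985) 75–102 [Balaban1985RegularSpaces] Thm 2 p.83, (1.36)–(1.38) p.82; CMP **102** (1985) 277–309 [Balaban1985Variational] (144) p.300,
(150)–(156) pp.301–302, (160) p.303; CMP **96** (1984) 223–250 [Balaban1984PropagatorsII] (2.1)–(2.2) p.224.
-/

set_option autoImplicit false

noncomputable section

open scoped BigOperators Matrix.Norms.L2Operator

namespace Summit.QuantumFields.YangMills.Theorems.HalvingP1FlatPillarPrimeRows

open Literature.MathematicalPhysics.QuantumFieldTheory.Balaban1983to89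
open Literature.MathematicalPhysics.QuantumFieldTheory.Balaban1983to89.T3ContinuumYM3Torus
open Literature.MathematicalPhysics.QuantumFieldTheory.Balaban1983to89.T3PrintedRegularMinimiser
open Literature.MathematicalPhysics.QuantumFieldTheory.Balaban1983to89.T3Thm1Carrier
open Literature.MathematicalPhysics.QuantumFieldTheory.Balaban1983to89.T3UnitLawDensityEML (ℰp)
open Literature.MathematicalPhysics.QuantumFieldTheory.Balaban1983to89.T3ConstrainedMinimiser (fibre)
open Complex (I)
open B6SectADomainsV1 (Domains)
open B6SectAOperatorsV1 (SiteIdx)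
open B7Prop1Explicit (expUnit)
open B8Eq140Level (SideTouches)
open B8Thm2SetupTorus (pullDom)
open B10Eq27TorusAxialLog (transl unitsField toUField suIncl)
open LatticeFieldCalculus (laplace diverg siteAvgIter)
open FlatCubeOpsText (IsLevWeight)
open FlatCubeSequenceAligned (cubeSeqMT3 cubeSetM)
open HalvingP1FlatPillar (DP1Clause)
open HalvingP1FlatPillarPrime (P1FlatPillarAt' P1FlatPillar' sideTouches_subset_cube0)
open HalvingP1FlatPillarRows (near160_of_core far155_of_size152)
open HalvingP1FlatCoreExtraction (core'_of_mlogChart)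
open MatrixLog (mlog)
open B6SectAOperatorsV1 (RE dsE)

variable {F : T3Family} {n K : ℕ}

/-! ## §1 `P1FlatPillarAt′` from `core′` at one site -/

/-- ★ **`P1FlatPillarAt′` FROM ITS CORE** — given the cube data (`R′M ≤ S`, `2L ≤ R′M + 1`, `1 ≤ S`), `U ∈ 𝔅_k(V)` over a (7)-datum (`PlaqSmall ε₁ V`), `0 ≤ ε₁`,
`0 < ε₀`, the regimes `12(ρ+M)ε₁ ≤ 1` and `60800·((d+2)L)²·L·(B₁+1)ε₀ ≤ 1`, and `core′` = `∃ u A, (o) DP1Clause ∧ (i) sa∕tr ∧ (ii′) chart identity on the bonds of the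
level-0 cube □₀ ∧ (iii) (1.36)♭ sizes ∧ (iv) Landau multiplier form` (VERBATIM the first five conjunct groups of ✓`P1FlatPillarAt'` at `Ω₀ := cubeSetM x (K−n) ρ S M 0`),
the primed pillar holds with `C₁ = 6`, `C₂ = 8L(B₁ + 1)`: (vi) by ✓`near160_of_core` on the layer chart read off (ii′) through ✓`sideTouches_subset_cube0`, (vii) by
✓`far155_of_size152`. [cite: Balaban1985RegularSpaces, Thm 2 p.83, (1.36)-(1.38) p.82; Balaban1985Variational, (144) p.300, (152)-(156) pp.301-302, (160) p.303] -/
theorem p1FlatPillarAt'_of_core' (hnK : n < K) (x : Site (F.P K) 0) (ρ S M : ℕ) (hM : 1 ≤ M) {R' : ℕ} (hRS : R' * M ≤ S)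
    (hRM : 2 * (F.P K).L ≤ R' * M + 1) (hS : 1 ≤ S) {ε₀ ε₁ B₁ : ℝ} (hε₁ : 0 ≤ ε₁) (hε₀ : 0 < ε₀)
    (hreg₁ : 12 * ((ρ : ℝ) + (M : ℝ)) * ε₁ ≤ 1)
    (hreg₀ : 16 * 3800 * ((((F.P K).d + 2) * (F.P K).L : ℕ) : ℝ) ^ 2 * (F.L : ℝ) * ((B₁ + 1) * ε₀) ≤ 1)
    {V : GaugeField (F.P n) 0 (Matrix.specialUnitaryGroup (Fin 2) ℂ)} {U : GaugeField (F.P K) 0 (Matrix.specialUnitaryGroup (Fin 2) ℂ)}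
    (hU : U ∈ fibre F ℰp n K hnK.le V) (hV : PlaqSmall ε₁ V)
    (core' : ∃ (u : GaugeTransf (F.P K) 0 (Matrix.unitaryGroup (Fin 2) ℂ)) (A : PBond (F.P K) 0 → Matrix (Fin 2) (Fin 2) ℂ),
      DP1Clause F n K (cubeSeqMT3 F n K x ρ S M hM) x U u ∧
      (∀ b : PBond (F.P K) 0, IsSelfAdjoint (A b)) ∧ (∀ b : PBond (F.P K) 0, Matrix.trace (A b) = 0) ∧
      (∀ (z : B7Prop1Explicit.Site (F.P K).d) (μ : Fin (F.P K).d), transl (0 : Site (F.P K) 0) z ∈ cubeSetM x (K - n) ρ S M 0 →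
        (transl (0 : Site (F.P K) 0) z).shift μ ∈ cubeSetM x (K - n) ρ S M 0 →
        (Unitary.toUnits (u (transl 0 z)))⁻¹ * unitsField (toUField U) ⟨transl 0 z, μ⟩ * Unitary.toUnits (u ((transl 0 z).shift μ)) =
          expUnit (I • ((((F.L : ℝ)⁻¹) ^ (K - n)) • A ⟨transl 0 z, μ⟩))) ∧
      (∀ w : ℕ → PBond (F.P K) 0 → ℝ, IsLevWeight F n K (cubeSeqMT3 F n K x ρ S M hM) w →
        (∀ b : PBond (F.P K) 0, w 1 b * ‖A b‖ ≤ B₁ * ε₀) ∧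
        (∀ (b : PBond (F.P K) 0) (ν : Fin (F.P K).d), w 2 b * (F.L : ℝ) ^ (K - n) * ‖A ⟨b.src.shift ν, b.dir⟩ - A b‖ ≤ B₁ * ε₀)) ∧
      (∃ μ : SiteIdx (cubeSeqMT3 F n K x ρ S M hM) → Matrix (Fin 2) (Fin 2) ℂ, ∀ s : Site (F.P K) 0,
        laplace ((F.L : ℝ) ^ (K - n)) (diverg ((F.L : ℝ) ^ (K - n)) A) s =
          ∑ i : SiteIdx (cubeSeqMT3 F n K x ρ S M hM), siteAvgIter (i.1.1 : ℕ) (Pi.single s (1 : ℝ)) i.1.2 • μ i)) :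
    P1FlatPillarAt' F n K (cubeSeqMT3 F n K x ρ S M hM) (cubeSetM x (K - n) ρ S M 0) x ε₀ ε₁ B₁ 6 (8 * (F.L : ℝ) * (B₁ + 1)) U := by
  obtain ⟨u, A, ho, hsa, htr, hchart', hsize, hslice⟩ := core'
  -- the chart on the member's positive-level layers, read off (ii′) on `□₀`
  have hchart : ∀ j, 1 ≤ j → j ≤ K - n → ∀ (z : B7Prop1Explicit.Site (F.P K).d) (μ : Fin (F.P K).d),
      SideTouches (pullDom (fun i => {y : Site (F.P K) 0 | (cubeSeqMT3 F n K x ρ S M hM).InOm i y}) j) z μ →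
      (Unitary.toUnits (u (transl 0 z)))⁻¹ * unitsField (toUField U) ⟨transl 0 z, μ⟩ * Unitary.toUnits (u ((transl 0 z).shift μ)) =
        expUnit (I • ((((F.L : ℝ)⁻¹) ^ (K - n)) • A ⟨transl 0 z, μ⟩)) := by
    intro j h1 hjk z μ hz
    have hΩ := sideTouches_subset_cube0 (F := F) (n := n) (K := K) x ρ S M hM hS j h1 hjk z μ hz
    exact hchart' z μ hΩ.1 hΩ.2
  refine ⟨u, A, ho, hsa, htr, hchart', hsize, hslice, near160_of_core hnK x ρ S M hM hε₁ hreg₁ hU hV ho hchart, fun c => ?_⟩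
  have h := far155_of_size152 x ρ S M hM hRS hRM hε₀ hreg₀ (fun w hw => (hsize w hw).1) c
  linarith

/-! ## §2 The ROOMED `P1FlatPillar′` text from a `core′` supplier at every site with room -/

/-- ★★ **THE ROOMED `P1FlatPillar′` TEXT FROM THE CORE AT EVERY SITE WITH ROOM** — the outer knit for the primed text under ★★OWNER RULING №27 (1) ∕ LEAD-H L-4
(room premise `2·ρ + Nr ≤ F.L ^ (F.m + n)` right after `hnK`; body = ✓`P1FlatPillar'` unfolded): for constants with `0 < Cr`, `12(ρ + M)·a ≤ Cr` and
`60800·(5L)²·L·(B₁ + 1)·a ≤ 1`, cube data `R′M ≤ S`, `2L ≤ R′M + 1`, `1 ≤ S`, a `core′` supplier at every member∕site WITH ROOM (the output of the flat one-contraction J1–J4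
read through ✓`HalvingP1FlatCoreExtraction.core'_of_mlogChart`) gives the roomed primed pillar with `C₁ = 6`, `C₂ = 8L(B₁+1)` — the body of the door successor's `hP1room`
at fixed `(B₁, Nr, ρ, a, Cr)`. [cite: Balaban1985RegularSpaces, Thm 2 p.83, (1.36)-(1.38) p.82; Balaban1985Variational, Prop 2 p.281, (144) p.300, (152)-(156) pp.301-302, (160) p.303] -/
theorem p1FlatPillar'_room_of_core' (L ρ S M Nr : ℕ) (hM : 1 ≤ M) {R' : ℕ} (hRS : R' * M ≤ S) (hRM : 2 * L ≤ R' * M + 1) (hS : 1 ≤ S) {a Cr B₁ : ℝ}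
    (hCr : 0 < Cr) (hreg₁ : 12 * ((ρ : ℝ) + (M : ℝ)) * a ≤ Cr) (hreg₀ : 16 * 3800 * ((5 * L : ℕ) : ℝ) ^ 2 * (L : ℝ) * ((B₁ + 1) * a) ≤ 1) (hB₁ : 0 ≤ B₁ + 1)
    (core' : ∀ F : T3Family, F.L = L → ∀ (n K : ℕ) (hnK : n < K), 2 * ρ + Nr ≤ F.L ^ (F.m + n) → ∀ (ε₀ ε₁ : ℝ), 0 < ε₁ → 0 < ε₀ → ε₀ ≤ a → Cr * ε₁ ≤ ε₀ →
      ∀ V : GaugeField (F.P n) 0 (Matrix.specialUnitaryGroup (Fin 2) ℂ), PlaqSmall ε₁ V →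
        ∀ U ∈ regFibrePr F n K hnK.le ε₀ V, ∀ x : Site (F.P K) 0,
          ∃ (u : GaugeTransf (F.P K) 0 (Matrix.unitaryGroup (Fin 2) ℂ)) (A : PBond (F.P K) 0 → Matrix (Fin 2) (Fin 2) ℂ),
            DP1Clause F n K (cubeSeqMT3 F n K x ρ S M hM) x U u ∧
            (∀ b : PBond (F.P K) 0, IsSelfAdjoint (A b)) ∧ (∀ b : PBond (F.P K) 0, Matrix.trace (A b) = 0) ∧
            (∀ (z : B7Prop1Explicit.Site (F.P K).d) (μ : Fin (F.P K).d), transl (0 : Site (F.P K) 0) z ∈ cubeSetM x (K - n) ρ S M 0 →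
              (transl (0 : Site (F.P K) 0) z).shift μ ∈ cubeSetM x (K - n) ρ S M 0 →
              (Unitary.toUnits (u (transl 0 z)))⁻¹ * unitsField (toUField U) ⟨transl 0 z, μ⟩ * Unitary.toUnits (u ((transl 0 z).shift μ)) =
                expUnit (I • ((((F.L : ℝ)⁻¹) ^ (K - n)) • A ⟨transl 0 z, μ⟩))) ∧
            (∀ w : ℕ → PBond (F.P K) 0 → ℝ, IsLevWeight F n K (cubeSeqMT3 F n K x ρ S M hM) w →
              (∀ b : PBond (F.P K) 0, w 1 b * ‖A b‖ ≤ B₁ * ε₀) ∧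
              (∀ (b : PBond (F.P K) 0) (ν : Fin (F.P K).d), w 2 b * (F.L : ℝ) ^ (K - n) * ‖A ⟨b.src.shift ν, b.dir⟩ - A b‖ ≤ B₁ * ε₀)) ∧
            (∃ μ : SiteIdx (cubeSeqMT3 F n K x ρ S M hM) → Matrix (Fin 2) (Fin 2) ℂ, ∀ s : Site (F.P K) 0,
              laplace ((F.L : ℝ) ^ (K - n)) (diverg ((F.L : ℝ) ^ (K - n)) A) s =
                ∑ i : SiteIdx (cubeSeqMT3 F n K x ρ S M hM), siteAvgIter (i.1.1 : ℕ) (Pi.single s (1 : ℝ)) i.1.2 • μ i)) :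
    ∀ F : T3Family, F.L = L → ∀ (n K : ℕ) (hnK : n < K), 2 * ρ + Nr ≤ F.L ^ (F.m + n) → ∀ (ε₀ ε₁ : ℝ), 0 < ε₁ → 0 < ε₀ → ε₀ ≤ a → Cr * ε₁ ≤ ε₀ →
      ∀ V : GaugeField (F.P n) 0 (Matrix.specialUnitaryGroup (Fin 2) ℂ), PlaqSmall ε₁ V →
        ∀ U ∈ regFibrePr F n K hnK.le ε₀ V, ∀ x : Site (F.P K) 0,
          P1FlatPillarAt' F n K (cubeSeqMT3 F n K x ρ S M hM) (cubeSetM x (K - n) ρ S M 0) x ε₀ ε₁ B₁ 6 (8 * (L : ℝ) * (B₁ + 1)) U := by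
  intro F hF n K hnK hroom ε₀ ε₁ hε₁ hε₀ hε₀a hCrε V hV U hU x
  have hfib := ((mem_regFibrePr_iff F).1 hU).1
  -- the two regimes from `Cr·ε₁ ≤ ε₀ ≤ a`
  have hρM : 0 ≤ (ρ : ℝ) + (M : ℝ) := by positivity
  have hε₁a : Cr * ε₁ ≤ a := hCrε.trans hε₀a
  have h1 : 12 * ((ρ : ℝ) + (M : ℝ)) * ε₁ ≤ 1 := by
    have h12 : 12 * ((ρ : ℝ) + (M : ℝ)) * (Cr * ε₁) ≤ Cr * 1 := by nlinarith
    have : 12 * ((ρ : ℝ) + (M : ℝ)) * ε₁ * Cr ≤ 1 * Cr := by nlinarith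
    exact le_of_mul_le_mul_right this hCr
  have hL : ((((F.P K).d + 2) * (F.P K).L : ℕ) : ℝ) = ((5 * L : ℕ) : ℝ) := by
    rw [T3Family.P_d, show (F.P K).L = F.L from rfl, hF]
  have h0 : 16 * 3800 * ((((F.P K).d + 2) * (F.P K).L : ℕ) : ℝ) ^ 2 * (F.L : ℝ) * ((B₁ + 1) * ε₀) ≤ 1 := by
    rw [hL, hF]
    have hc : 0 ≤ 16 * 3800 * ((5 * L : ℕ) : ℝ) ^ 2 * (L : ℝ) * (B₁ + 1) := by positivity
    calc 16 * 3800 * ((5 * L : ℕ) : ℝ) ^ 2 * (L : ℝ) * ((B₁ + 1) * ε₀)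
        = 16 * 3800 * ((5 * L : ℕ) : ℝ) ^ 2 * (L : ℝ) * (B₁ + 1) * ε₀ := by ring
      _ ≤ 16 * 3800 * ((5 * L : ℕ) : ℝ) ^ 2 * (L : ℝ) * (B₁ + 1) * a := mul_le_mul_of_nonneg_left hε₀a hc
      _ = 16 * 3800 * ((5 * L : ℕ) : ℝ) ^ 2 * (L : ℝ) * ((B₁ + 1) * a) := by ring
      _ ≤ 1 := hreg₀
  have hRM' : 2 * (F.P K).L ≤ R' * M + 1 := by
    rw [show (F.P K).L = F.L from rfl, hF]; exact hRM
  have h := p1FlatPillarAt'_of_core' hnK x ρ S M hM hRS hRM' hS hε₁.le hε₀ h1 h0 hfib hV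
    (core' F hF n K hnK hroom ε₀ ε₁ hε₁ hε₀ hε₀a hCrε V hV U hU x)
  have hFL : (8 * (F.L : ℝ) * (B₁ + 1)) = 8 * (L : ℝ) * (B₁ + 1) := by rw [hF]
  rw [hFL] at h
  exact h

/-! ## §3 The ROOMED `P1FlatPillar′` text from J4's raw per-site output (through part 1's chart-defined extraction) -/

/-- ★★ **THE ROOMED `P1FlatPillar′` TEXT FROM THE FLAT ONE-CONTRACTION'S RAW OUTPUT AT EVERY SITE WITH ROOM** (room premise `2ρ + Nr ≤ L^{m+n}` after `hnK`, ★★OWNER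
RULING №27 (1) ∕ LEAD-H L-4): if at every member∕site with room J4 hands an `SU(2)`-valued gauge `u` with the D-P1 clause (o),
the near-identity `‖u(z)⁻¹U(b)u(z+e_μ) − 1‖ ≤ 1∕4` on the bonds with both ends in `□₀`, a one-form `A` defined there by `i·η·A(b) = log(u(z)⁻¹U(b)u(z+e_μ))` and `= 0`
off those bonds, the (1.36)♭ sizes (iii) and the exact slice `R∂*(φ∘A) = 0` for every real reading, then the roomed primed pillar text holds with `C₁ = 6`, `C₂ = 8L(B₁+1)`
(the body of the door successor's `hP1room` at fixed `(B₁, Nr, ρ, a, Cr)`) — §2 ∘ ✓`HalvingP1FlatCoreExtraction.core'_of_mlogChart`. [cite: Balaban1985RegularSpaces, Thm 2 p.83, (1.36)-(1.38) p.82; Balaban1985Variational, (144) p.300, (152)-(156) pp.301-302] -/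
theorem p1FlatPillar'_room_of_mlogChartData (L ρ S M Nr : ℕ) (hM : 1 ≤ M) {R' : ℕ} (hRS : R' * M ≤ S) (hRM : 2 * L ≤ R' * M + 1) (hS : 1 ≤ S)
    {a Cr B₁ : ℝ} (hCr : 0 < Cr) (hreg₁ : 12 * ((ρ : ℝ) + (M : ℝ)) * a ≤ Cr)
    (hreg₀ : 16 * 3800 * ((5 * L : ℕ) : ℝ) ^ 2 * (L : ℝ) * ((B₁ + 1) * a) ≤ 1) (hB₁ : 0 ≤ B₁ + 1)
    (hJ4 : ∀ F : T3Family, F.L = L → ∀ (n K : ℕ) (hnK : n < K), 2 * ρ + Nr ≤ F.L ^ (F.m + n) → ∀ (ε₀ ε₁ : ℝ), 0 < ε₁ → 0 < ε₀ → ε₀ ≤ a → Cr * ε₁ ≤ ε₀ →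
      ∀ V : GaugeField (F.P n) 0 (Matrix.specialUnitaryGroup (Fin 2) ℂ), PlaqSmall ε₁ V →
        ∀ U ∈ regFibrePr F n K hnK.le ε₀ V, ∀ x : Site (F.P K) 0,
          ∃ (u : GaugeTransf (F.P K) 0 (Matrix.specialUnitaryGroup (Fin 2) ℂ)) (A : PBond (F.P K) 0 → Matrix (Fin 2) (Fin 2) ℂ),
            DP1Clause F n K (cubeSeqMT3 F n K x ρ S M hM) x U (fun s => suIncl (u s)) ∧
            (∀ (z : B7Prop1Explicit.Site (F.P K).d) (μ : Fin (F.P K).d), transl (0 : Site (F.P K) 0) z ∈ cubeSetM x (K - n) ρ S M 0 →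
              (transl (0 : Site (F.P K) 0) z).shift μ ∈ cubeSetM x (K - n) ρ S M 0 →
              ‖(((Unitary.toUnits (suIncl (u (transl 0 z))))⁻¹ * unitsField (toUField U) ⟨transl 0 z, μ⟩ *
                  Unitary.toUnits (suIncl (u ((transl 0 z).shift μ))) : (Matrix (Fin 2) (Fin 2) ℂ)ˣ) : Matrix (Fin 2) (Fin 2) ℂ) - 1‖ ≤ 1 / 4) ∧
            (∀ (z : B7Prop1Explicit.Site (F.P K).d) (μ : Fin (F.P K).d), transl (0 : Site (F.P K) 0) z ∈ cubeSetM x (K - n) ρ S M 0 →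
              (transl (0 : Site (F.P K) 0) z).shift μ ∈ cubeSetM x (K - n) ρ S M 0 →
              I • ((((F.L : ℝ)⁻¹) ^ (K - n)) • A ⟨transl 0 z, μ⟩) =
                mlog (((Unitary.toUnits (suIncl (u (transl 0 z))))⁻¹ * unitsField (toUField U) ⟨transl 0 z, μ⟩ *
                  Unitary.toUnits (suIncl (u ((transl 0 z).shift μ))) : (Matrix (Fin 2) (Fin 2) ℂ)ˣ) : Matrix (Fin 2) (Fin 2) ℂ)) ∧
            (∀ b : PBond (F.P K) 0, ¬ (∃ z : B7Prop1Explicit.Site (F.P K).d, transl (0 : Site (F.P K) 0) z ∈ cubeSetM x (K - n) ρ S M 0 ∧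
              (transl (0 : Site (F.P K) 0) z).shift b.dir ∈ cubeSetM x (K - n) ρ S M 0 ∧ b = ⟨transl 0 z, b.dir⟩) → A b = 0) ∧
            (∀ w : ℕ → PBond (F.P K) 0 → ℝ, IsLevWeight F n K (cubeSeqMT3 F n K x ρ S M hM) w →
              (∀ b : PBond (F.P K) 0, w 1 b * ‖A b‖ ≤ B₁ * ε₀) ∧
              (∀ (b : PBond (F.P K) 0) (ν : Fin (F.P K).d), w 2 b * (F.L : ℝ) ^ (K - n) * ‖A ⟨b.src.shift ν, b.dir⟩ - A b‖ ≤ B₁ * ε₀)) ∧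
            (∀ φ : Matrix (Fin 2) (Fin 2) ℂ →ₗ[ℝ] ℝ,
              RE (cubeSeqMT3 F n K x ρ S M hM) ((F.L : ℝ) ^ (K - n))
                (dsE ((F.L : ℝ) ^ (K - n)) (WithLp.toLp 2 (fun b => φ (A b)))) = 0)) :
    ∀ F : T3Family, F.L = L → ∀ (n K : ℕ) (hnK : n < K), 2 * ρ + Nr ≤ F.L ^ (F.m + n) → ∀ (ε₀ ε₁ : ℝ), 0 < ε₁ → 0 < ε₀ → ε₀ ≤ a → Cr * ε₁ ≤ ε₀ →
      ∀ V : GaugeField (F.P n) 0 (Matrix.specialUnitaryGroup (Fin 2) ℂ), PlaqSmall ε₁ V →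
        ∀ U ∈ regFibrePr F n K hnK.le ε₀ V, ∀ x : Site (F.P K) 0,
          P1FlatPillarAt' F n K (cubeSeqMT3 F n K x ρ S M hM) (cubeSetM x (K - n) ρ S M 0) x ε₀ ε₁ B₁ 6 (8 * (L : ℝ) * (B₁ + 1)) U := by
  refine p1FlatPillar'_room_of_core' L ρ S M Nr hM hRS hRM hS hCr hreg₁ hreg₀ hB₁
    fun F hF n K hnK hroom ε₀ ε₁ hε₁ hε₀ hε₀a hCrε V hV U hU x => ?_
  obtain ⟨u, A, ho, hnear, hA, hA0, hsize, hslice⟩ := hJ4 F hF n K hnK hroom ε₀ ε₁ hε₁ hε₀ hε₀a hCrε V hV U hU x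
  exact core'_of_mlogChart (cubeSeqMT3 F n K x ρ S M hM) (cubeSetM x (K - n) ρ S M 0) x u A ho hnear hA hA0 hsize hslice

end Summit.QuantumFields.YangMills.Theorems.HalvingP1FlatPillarPrimeRows

end
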